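import Mathlib
import Summits.NavierStokesRegularity.NavierStokesRegularity.Theorems.ThreadingFluxAzimuthalCartanDefs
import Summits.NavierStokesRegularity.NavierStokesRegularity.Theorems.ThreadingFluxAzimuthalCartanVertexWitnessNonEquivariant
import Summits.NavierStokesRegularity.NavierStokesRegularity.Theorems.ThreadingFluxAzimuthalCartanVertexWitnessLaplacian
import HarnessLib

/-!
# Crux `PoloidalLiouville` (stmt-NavierStokesRegularity-1222, W1), crux idea «azimuthal-cartan-test» (ns-idea-15 g10, V26),
# V♯ `LandauVertexFlexibility` ⇐ the linearised MOMENTUM identity for the explicit witness (sharpened reduction)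

`…VertexWitnessNonEquivariant.lean` reduces V♯ (`LandauVertexFlexibility`, Defs twin) to `LinearisedSteadyNSOn landauTorus landau2 δv δp` for the
explicit mode-2 witness `(δv, δp)` of the crux note `AzimuthalCartanVertexWitness.md`; `…VertexWitnessLaplacian.lean` proves the divergence
half of that clause (`divergence_witness_landauTorus`).  Hence ★★ `landauVertexFlexibility_of_momentum`: V♯ follows from the momentum half
ALONE — the pointwise identity `Dδv(x)(U x) + DU(x)(δv x) + ∇δp(x) = Δδv(x)` on `landauTorus` (U = `landau2`), an explicit third-order
rational–radial identity verified exactly outside Lean (`kb/symbolic_check.py`) and NOT proved here.  V♯, `PoloidalLiouville` (1222), W1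
and NS regularity stay OPEN / NOT proved.  `--supports stmt-NavierStokesRegularity-1222 --as helper`; 0 kit.  [folklore]
-/

-- the summit and its single problem share the name (D-0017 nested layout)
set_option linter.dupNamespace false

noncomputable section

open scoped RealInnerProductSpace
open Literature.Analysis.FluidPDE

namespace Summit.NavierStokesRegularity.NavierStokesRegularity.Theorems.PoloidalLiouville.AzimuthalCartan

open Summit.NavierStokesRegularity.NavierStokesRegularity.Theorems.PoloidalLiouville.CentreJet (E3)

namespace VertexWitness

/-- ★★ **V♯ from the momentum identity alone.**  If the explicit witness pair satisfies the steady Navier–Stokes momentum equation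
linearised at Landau's flow on the torus, `Dδv(x)(U x) + DU(x)(δv x) + ∇δp(x) = Δδv(x)` for `x ∈ landauTorus`, then
`LandauVertexFlexibility` holds (divergence: `divergence_witness_landauTorus`; the other four conjuncts:
`landauVertexFlexibility_of_linearisedSteadyNSOn`).  The hypothesis is NOT proved in the tree. [folklore] -/
theorem landauVertexFlexibility_of_momentum
    (h : ∀ x ∈ landauTorus,
      fderiv ℝ (fun y : E3 =>
          gradient (fun y : E3 => (y 0 ^ 2 - y 1 ^ 2) * (10 * ‖y‖ - 8 * y 2) / ((‖y‖ - y 2) ^ 2 * (2 * ‖y‖ - y 2))) y +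
            (6 * ((y 0 ^ 2 - y 1 ^ 2) * (10 * ‖y‖ - 8 * y 2) / ((‖y‖ - y 2) ^ 2 * (2 * ‖y‖ - y 2))) / (2 * ‖y‖ - y 2) ^ 2) • y)
          x (landau2 x) +
        fderiv ℝ landau2 x ((fun y : E3 =>
          gradient (fun y : E3 => (y 0 ^ 2 - y 1 ^ 2) * (10 * ‖y‖ - 8 * y 2) / ((‖y‖ - y 2) ^ 2 * (2 * ‖y‖ - y 2))) y +
            (6 * ((y 0 ^ 2 - y 1 ^ 2) * (10 * ‖y‖ - 8 * y 2) / ((‖y‖ - y 2) ^ 2 * (2 * ‖y‖ - y 2))) / (2 * ‖y‖ - y 2) ^ 2) • y)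
          x) +
        gradient (fun y : E3 =>
          6 * ((y 0 ^ 2 - y 1 ^ 2) * (10 * ‖y‖ - 8 * y 2) / ((‖y‖ - y 2) ^ 2 * (2 * ‖y‖ - y 2))) / (2 * ‖y‖ - y 2) ^ 2 -
            inner ℝ (gradient (fun y : E3 => Real.log (3 * ‖y‖ ^ 2 / (2 * ‖y‖ - y 2) ^ 2)) y)
              (gradient (fun y : E3 => (y 0 ^ 2 - y 1 ^ 2) * (10 * ‖y‖ - 8 * y 2) / ((‖y‖ - y 2) ^ 2 * (2 * ‖y‖ - y 2))) y)) x =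
      Laplacian.laplacian (fun y : E3 =>
          gradient (fun y : E3 => (y 0 ^ 2 - y 1 ^ 2) * (10 * ‖y‖ - 8 * y 2) / ((‖y‖ - y 2) ^ 2 * (2 * ‖y‖ - y 2))) y +
            (6 * ((y 0 ^ 2 - y 1 ^ 2) * (10 * ‖y‖ - 8 * y 2) / ((‖y‖ - y 2) ^ 2 * (2 * ‖y‖ - y 2))) / (2 * ‖y‖ - y 2) ^ 2) • y)
          x) :
    LandauVertexFlexibility :=
  landauVertexFlexibility_of_linearisedSteadyNSOn ⟨divergence_witness_landauTorus, h⟩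

end VertexWitness

end Summit.NavierStokesRegularity.NavierStokesRegularity.Theorems.PoloidalLiouville.AzimuthalCartan
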